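import Mathlib.GroupTheory.DoubleCoset
import Literature.AnabelianGeometry.SemiGraphs.Coverticial
import Literature.AnabelianGeometry.SemiGraphs.PullbackFunctor
import Literature.AnabelianGeometry.SemiGraphs.FiniteEtaleCoveringGlobalDef
import Literature.AnabelianGeometry.SemiGraphs.FiniteEtaleCoveringVertexAligned

/-!
# The finite étale covering dictionary for semi-graphs of anabelioids ([SemiAnbd] §2) — STATEMENTS

Mochizuki, *Semi-graphs of anabelioids*, Publ. RIMS **42** (2006) 221–322, §2, author's
manuscript pp. 23–30 [cite: MochizukiSemiAnbd2006, §2 pp.23-30].  abc-iut cell, layer L3,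
DISCHARGE-L3 §G row G30 (L3-lead RULING ω, 2026-08-25): ONE statements file naming, as `def … :
Prop` facts WITHOUT proofs, the dictionary between a finite étale covering `φ : 𝒢′ → 𝒢` attached to
an object `A ∈ B(𝒢)` (Definition 2.2 (i), typed by abc-iut-L3-t1 as `Hom.IsFiniteEtaleCoveringOf`,
`Coverticial.lean`) and the open subgroups of `Π_𝒢`, which the printed proofs of Proposition 2.6
(p. 29, l. −12: "it suffices [by replacing `𝒢` by a finite étale covering of `𝒢`] to show …") and of
Corollary 2.7 (i) (p. 30: "Thus, assertion (i) follows from Proposition 2.6" — applied INSIDE the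
covering `𝒢′` to the components `ℋ″`, `g·ℋ″`) use without comment:

* (D0) the induced basepoint `φ_{v′}^* ⋙ β′` of `𝒢_v` is a basepoint;
* (D1) `Π_{𝒢′} → Π_𝒢` is injective with image the stabiliser (decomposition group) of a point of
  the fibre of `A` (p. 23 "finite étale coverings `𝒢′_{v′} → 𝒢_v`"; Remark 2.2.1, p. 24,
  "stabilizer"; [SGA1, Exp. V]);
* (D2) the vertices of `𝒢′` over `v` ↔ the double cosets `Π_v \ Π_𝒢 / Π_{𝒢′}`, the verticial
  subgroups of `𝒢′` being `Π_{𝒢′} ∩ g⁻¹ Π_v g` (p. 23: "the vertices of `𝒢′` that lie over `v`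
  [are] the connected components of `S_v`"; Remark 2.2.1);
* (D3) the same for a connected sub-semi-graph `ℍ ∋ v`: connected components of `φ⁻¹(ℍ)` ↔
  `Π_ℍ \ Π_𝒢 / Π_{𝒢′}` with groups `Π_{𝒢′} ∩ g⁻¹ Π_ℍ g` (p. 30, proof of Cor. 2.7 (i): "`ℋ′` injects
  into `𝒢′` as a subgraph", the components `ℋ″` and `g · ℋ″`);
* (D8) the covering attached to a connected object is connected (p. 23, p. 30), and (D9) has a
  vertex over every vertex;
* (D4)–(D7) finite étale coverings of semi-graphs of anabelioids of injective type / quasi-coherent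
  / with an elevated vertex / totally estranged (aloof) are again such — IMPLICIT in print (used
  when Prop. 2.6 is applied to a covering, pp. 29–30), flagged as implicit below.

v2 (TREE-HEALTH RQ11 / RULING ζ2, finder abc-iut-L6-d4): `Hom.IsFiniteEtaleCoveringOf` is the
LOCAL description of the covering and does not pin its gluing, so (D1), (D2), (D3), (D6), (D7) now
also assume the GLOBAL clause ("`B(𝒢′) = B(𝒢)_{/A}` via `φ^*`"; since v3 spelled
`φ.IsGlobalCoveringOf A`, `FiniteEtaleCoveringGlobalDef.lean`, RULING π2); (D3) moreover takes `ℍ`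
to be a sub-GRAPH and its components to be graphs, aligning with the RQ10 guard of
`corollary_2_7_i` (Commensurability v3) /
`proposition_2_6`; v3 (TREE-HEALTH RQ14 / RULING μ2, finder abc-iut-L4-t17): the 2-cells `φ_{b′}`
are data, so (D5), (D6), (D7) also assume `φ.IsBranchAligned` (`FiniteEtaleCoveringGlobalDef.lean`),
and (RQ17 / RULING ρ2, finder abc-iut-L6-d4) the local factorisation base points are not tied to the
global one, so (D2), (D3) also assume `φ.IsVertexAligned` (`FiniteEtaleCoveringVertexAligned.lean`);
v3 also adds the four-clause existence fact `exists_finiteEtaleCoveringGlobal`; v4 (RULINGS τ2/ψ2,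
finder abc-iut-L6-d4): in (D2) and (D3) the group clause no longer ties the conjugating element `g`
of a vertex `v″` / component `K` to the double coset `d v″` / `d K` (the tie is a labelling statement
not derivable from the pure-group-form `IsVertexAligned`; consumers needing it — e.g. Cor. 2.7 (i) —
derive it from Prop. 2.6 by pigeonhole); (D0), (D4), (D8), (D9) are unchanged throughout.  Honest framing: all alignment
hypotheses hold for print's `B(𝒢)_{/A}`-construction and are explicit only because `Hom`-based
predicates under-specify base points.

Basepoints (cell convention, `GraphOfAnabelioids.lean` note 3): through a vertex `v′` of `𝒢′` with
basepoint `β′ = F′` of `𝒢′_{v′}`, together with ANY basepoint `F` of `𝒢_v`, `v = φ(v′)`, and an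
identification `e : φ_{v′}^* ⋙ F′ ≅ F` with the induced one; `Π_{𝒢′} → Π_𝒢` is then
`pi1Map φ^* (ρ′_{v′} ⋙ F′)` for t1's pull-back functor `φ^* : B(𝒢) ⥤ B(𝒢′)` (`PullbackFunctor.lean`;
`φ^* ⋙ ρ′_{v′} = ρ_v ⋙ φ_{v′}^*` holds by `rfl`) followed by the transport `Aut(ρ_v ⋙ e)`.
"Well-defined up to conjugation" becomes "for every transport isomorphism of basepoints `α`".
At the level of a single constituent anabelioid this composite is abc-iut-L6-t17's interface of
record (`FiniteEtaleLocalDictionary.lean`, `…Lift`, `…Stabilizer`: `range_pi1Map_eq_stabilizer` with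
`S := P`, `Q := (φ.φV v′).pullback`, `e`, `β`); (D0)–(D3) are its `B(𝒢)`-level counterparts.

G1 (junk/vacuity) tests, recorded per declaration: the hypotheses are inhabited by the finite
étale coverings coming from finite graph-coverings of the underlying graph (abc-iut-L3-d1,
`comapHom_isFiniteEtaleCoveringOf`, `GraphCoveringEtale.lean`); for the trivial covering
(`A` terminal, `𝒢′ = 𝒢`) (D1)/(D2)/(D3) specialise to "`ι` bijective, one double coset" — consistent
and not vacuous; (D4)–(D7) have non-trivial conclusions (they are the hypotheses of Prop. 2.6 for
`𝒢′`).  NOT here (RULING ω): the EXISTENCE of the covering attached to `A`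
(`exists_finiteEtaleCovering`, abc-iut-L3-t5) and "open normal subgroup ↦ Galois object"
(`bOf_galoisCategory`, abc-iut-L3-t9); no `_holds` (dischargers: abc-iut-L6-t17 for (D0)–(D3),
abc-iut-L3-t5 for (D4)–(D7)); the edge/branch analogue of (D2) is deferred.
Nothing here takes a side on [IUTchIII] Cor. 3.12; typed ≠ discharged.
-/

namespace Literature.AnabelianGeometry.SemiGraphs

open CategoryTheory CategoryTheory.Limits CategoryTheory.PreGaloisCategory
open Literature.AnabelianGeometry.Anabelioids
open scoped Pointwise

universe v₁ u₁ u

namespace SemiGraphOfAnabelioids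

/-! ### (D0)–(D1): the induced basepoint and the decomposition group -/

/-- NAMED FACT (D0), [SemiAnbd] §2 p. 23 ("finite étale coverings `𝒢′_{v′} → 𝒢_v`"; implicit): for
a finite étale covering `φ : 𝒢′ → 𝒢` attached to `A` and a basepoint `F′` of `𝒢′_{v′}`, the induced
functor `φ_{v′}^* ⋙ F′` is a basepoint (fibre functor) of `𝒢_v`.  G1: for the identity covering
`φ_{v′}^* ≅ 𝟭` and the claim is `FiberFunctor F′`. [cite: MochizukiSemiAnbd2006, Def. 2.2(i) p.23] -/
def covering_fiberFunctor : Prop :=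
  ∀ (𝒢 𝒢' : SemiGraphOfAnabelioids.{v₁, u₁, u}) (φ : Hom 𝒢' 𝒢) (A : 𝒢.BObj),
    𝒢.IsConnected → φ.IsFiniteEtaleCoveringOf A →
    ∀ (v' : 𝒢'.graph.Vertex) (F' : 𝒢'.V v' ⥤ FintypeCat.{v₁}) [FiberFunctor F'],
      Nonempty (FiberFunctor ((φ.φV v').pullback ⋙ F'))

/-- NAMED FACT (D1, decomposition groups), [SemiAnbd] §2 p. 23 with Remark 2.2.1 (p. 24: "the image
of each `Π_v` … is equal to the stabilizer …"), [SGA1 V]: for a finite étale covering `φ : 𝒢′ → 𝒢`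
of connected semi-graphs of anabelioids attached to `A ∈ B(𝒢)` and basepoints as in the module
docstring, the homomorphism `ι = π₁(φ^*) : Π_{𝒢′} → Π_𝒢` is injective and its image is the stabiliser
in `Π_𝒢` of some point `x₀` of the fibre `F(A_v)` of `A` (the point singled out by the base vertex
`v′`).  G1: for the identity covering (`A` terminal) the fibre is a point and the claim is "`ι`
bijective"; hypotheses are met by graph-coverings (abc-iut-L3-d1 `comapHom_isFiniteEtaleCoveringOf`).
[cite: MochizukiSemiAnbd2006, Rem. 2.2.1 p.24] -/
def covering_decompositionGroup : Prop :=
  ∀ (𝒢 𝒢' : SemiGraphOfAnabelioids.{v₁, u₁, u}) (φ : Hom 𝒢' 𝒢) (A : 𝒢.BObj),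
    𝒢.IsConnected → 𝒢'.IsConnected → φ.IsFiniteEtaleCoveringOf A → φ.IsGlobalCoveringOf A →
    ∀ (v' : 𝒢'.graph.Vertex) (F' : 𝒢'.V v' ⥤ FintypeCat.{v₁}) [FiberFunctor F']
      (F : 𝒢.V (φ.base.vertexMap v') ⥤ FintypeCat.{v₁}) [FiberFunctor F]
      (e : (φ.φV v').pullback ⋙ F' ≅ F),
      let v := φ.base.vertexMap v'
      let ι : 𝒢'.Pi v' F' →* 𝒢.Pi v F :=
        (Aut.autMulEquivOfIso (Functor.isoWhiskerLeft (𝒢.ρ v) e)).toMonoidHom.comp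
          (pi1Map φ.pullbackFunctor (𝒢'.ρ v' ⋙ F'))
      ∃ x₀ : (𝒢.ρ v ⋙ F).obj A,
        Function.Injective ι ∧ ι.range = MulAction.stabilizer (𝒢.Pi v F) x₀

/-- NAMED FACT (D8, connectedness), [SemiAnbd] §2 p. 23 (the covering attached to `G′`: "we
assume that `B′` is connected"; the vertices/edges of `𝒢′` are the connected components of the
`S_v`, `T_e`) with p. 30 (proof of Cor. 2.7 (i): "a connected finite Galois étale covering
`𝒢′ → 𝒢`"): the finite étale covering attached to a CONNECTED object `A` of `B(𝒢)` (connected `𝒢`)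
is connected.  G1: for `A` terminal the covering is `𝒢` itself; the conclusion `IsConnected 𝒢′` is
non-trivial. [cite: MochizukiSemiAnbd2006, Def. 2.2(i) p.23] -/
def covering_isConnected : Prop :=
  ∀ (𝒢 𝒢' : SemiGraphOfAnabelioids.{v₁, u₁, u}) (φ : Hom 𝒢' 𝒢) (A : 𝒢.BObj),
    𝒢.IsConnected → φ.IsFiniteEtaleCoveringOf A → PreGaloisCategory.IsConnected A →
    𝒢'.IsConnected

/-- NAMED FACT (D9, vertices over every vertex), [SemiAnbd] §2 p. 23 (the covering attached to a
connected `B′`: its vertices over `v` "correspond to the connected components of `S_v`", and for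
connected `A` over connected `𝒢` no `S_v` is empty): for the finite étale covering attached to a
CONNECTED object `A` of `B(𝒢)`, `𝒢` connected, every vertex of `𝒢` has a vertex of `𝒢′` over it.
G1: conclusion non-trivial; false for `A` initial (then `𝒢′` is empty), which the connectedness
hypothesis excludes. [cite: MochizukiSemiAnbd2006, Def. 2.2(i) p.23] -/
def covering_vertexMap_surjective : Prop :=
  ∀ (𝒢 𝒢' : SemiGraphOfAnabelioids.{v₁, u₁, u}) (φ : Hom 𝒢' 𝒢) (A : 𝒢.BObj),
    𝒢.IsConnected → φ.IsFiniteEtaleCoveringOf A → PreGaloisCategory.IsConnected A →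
    Function.Surjective φ.base.vertexMap

/-! ### (D2): vertices over `v` ↔ `Π_v \ Π_𝒢 / Π_{𝒢′}`; verticial subgroups of the covering -/

/-- NAMED FACT (D2), [SemiAnbd] §2 p. 23 ("the vertices of `𝒢′` that lie over `v` [are] the connected
components of `S_v`") with Remark 2.2.1 (p. 24, stabilizers), in group-theoretic form: with
`Π′ := ι(Π_{𝒢′}) = Stab(x₀) ⊆ Π_𝒢` as in (D1) and `Π_v ⊆ Π_𝒢` the image of `piVToPi`, there is an
assignment `v″ ↦ d(v″) ∈ Π_𝒢` on the vertices of `𝒢′` over `v` inducing a BIJECTION onto the double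
cosets `Π_v \ Π_𝒢 / Π′`, with `d(v′) ∈ Π′` and `ι(Π_{v′}) = Π′ ∩ Π_v` at the base vertex, such
that for every such `v″`, every basepoint `F″` of
`𝒢′_{v″}` and every transport `α` of basepoints of `B(𝒢′)`, the image in `Π_𝒢` of the verticial
subgroup `Π_{v″} → Π_{𝒢′} → Π_𝒢` is `Π′ ∩ g⁻¹ Π_v g` for some `g` in the double coset of `d(v″)`.
G1: for the identity covering there is one vertex over `v`, one double coset, and the claim reads
`ι(Π_{v}) = Π_v`. [cite: MochizukiSemiAnbd2006, Def. 2.2(i) p.23] -/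
def covering_vertexFibre_doubleCosets : Prop :=
  ∀ (𝒢 𝒢' : SemiGraphOfAnabelioids.{v₁, u₁, u}) (φ : Hom 𝒢' 𝒢) (A : 𝒢.BObj),
    𝒢.IsConnected → 𝒢'.IsConnected → φ.IsFiniteEtaleCoveringOf A → φ.IsGlobalCoveringOf A →
    φ.IsVertexAligned →
    ∀ (v' : 𝒢'.graph.Vertex) (F' : 𝒢'.V v' ⥤ FintypeCat.{v₁}) [FiberFunctor F']
      (F : 𝒢.V (φ.base.vertexMap v') ⥤ FintypeCat.{v₁}) [FiberFunctor F]
      (e : (φ.φV v').pullback ⋙ F' ≅ F),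
      let v := φ.base.vertexMap v'
      let ι : 𝒢'.Pi v' F' →* 𝒢.Pi v F :=
        (Aut.autMulEquivOfIso (Functor.isoWhiskerLeft (𝒢.ρ v) e)).toMonoidHom.comp
          (pi1Map φ.pullbackFunctor (𝒢'.ρ v' ⋙ F'))
      let Pv : Subgroup (𝒢.Pi v F) := (𝒢.piVToPi v F).range
      ∀ x₀ : (𝒢.ρ v ⋙ F).obj A, ι.range = MulAction.stabilizer (𝒢.Pi v F) x₀ →
        ∃ d : {v'' : 𝒢'.graph.Vertex // φ.base.vertexMap v'' = v} → 𝒢.Pi v F,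
          Function.Bijective (fun v'' => DoubleCoset.mk Pv ι.range (d v'')) ∧
          d ⟨v', rfl⟩ ∈ ι.range ∧
          (ι.comp (𝒢'.piVToPi v' F')).range = ι.range ⊓ Pv ∧
          ∀ (v'' : {v'' : 𝒢'.graph.Vertex // φ.base.vertexMap v'' = v})
            (F'' : 𝒢'.V v''.1 ⥤ FintypeCat.{v₁}) [FiberFunctor F'']
            (α : 𝒢'.ρ v''.1 ⋙ F'' ≅ 𝒢'.ρ v' ⋙ F'),
            ∃ g : 𝒢.Pi v F,
              (ι.comp ((Aut.autMulEquivOfIso α).toMonoidHom.comp (𝒢'.piVToPi v''.1 F''))).range =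
                ι.range ⊓ ConjAct.toConjAct g⁻¹ • Pv

/-! ### (D3): connected components of `φ⁻¹(ℍ)` ↔ `Π_ℍ \ Π_𝒢 / Π_{𝒢′}` -/

variable {𝒢 𝒢' : SemiGraphOfAnabelioids.{v₁, u₁, u}}

/-- `K ⊆ 𝔾′` is a *connected component of the preimage* `φ⁻¹(ℍ)` of the sub-semi-graph `ℍ ⊆ 𝔾`
under `φ : 𝒢′ → 𝒢`: a connected sub-semi-graph of `𝔾′` which is a GRAPH (no dangling branches — the
tree-health RQ10 guard of `proposition_2_6`/`corollary_2_7_i`, automatic for components over a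
sub-GRAPH `ℍ` by properness), mapping into `ℍ`, containing a vertex, and maximal among the connected
sub-semi-graphs mapping into `ℍ` (the `ℋ″` of [SemiAnbd] p. 30, proof of Cor. 2.7 (i): "a connected
component `ℋ″` of `ℋ′`"). [cite: MochizukiSemiAnbd2006, Cor. 2.7(i) p.30] -/
def Hom.IsPreimageComponent (φ : Hom 𝒢' 𝒢) (H : 𝒢.graph.Subgraph) (K : 𝒢'.graph.Subgraph) : Prop :=
  K.toSemiGraph.IsConnected ∧ K.toSemiGraph.IsGraph ∧ K.verts.Nonempty ∧
    K.verts ⊆ φ.base.vertexMap ⁻¹' H.verts ∧ K.edges ⊆ φ.base.edgeMap ⁻¹' H.edges ∧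
    ∀ K' : 𝒢'.graph.Subgraph, K'.toSemiGraph.IsConnected →
      K'.verts ⊆ φ.base.vertexMap ⁻¹' H.verts → K'.edges ⊆ φ.base.edgeMap ⁻¹' H.edges →
      K.verts ⊆ K'.verts → K.edges ⊆ K'.edges → K' = K

/-- NAMED FACT (D3), [SemiAnbd] §2 p. 30 (proof of Corollary 2.7 (i): for the covering `𝒢′ → 𝒢`,
"whose restriction to `ℍ` … we denote by `ℋ′ → ℍ`", "a connected component `ℋ″` of `ℋ′` such that
`g · ℋ″ ≠ ℋ″`", "`ℋ′` injects into `𝒢′` as a subgraph"), in group-theoretic form: for a connected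
sub-semi-graph `ℍ ∋ v` which is a graph (RQ10 guard, as in `corollary_2_7_i`), with `Π_ℍ ⊆ Π_𝒢`
the image of `piHToPi`, and `Π′ = ι(Π_{𝒢′}) = Stab(x₀)` as in
(D1), there is an assignment `K ↦ d(K) ∈ Π_𝒢` on the connected components `K` of `φ⁻¹(ℍ)` inducing a
BIJECTION onto `Π_ℍ \ Π_𝒢 / Π′`, the component `ℋ″` through `v′` (which exists) going to the class
of `Π′` and having `ι(Π_{ℋ″}) = Π′ ∩ Π_ℍ` at the base vertex, such that the
image in `Π_𝒢` of `Π_K → Π_{𝒢′} → Π_𝒢` (any vertex `w″` of `K`, any basepoint, any transport) is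
`Π′ ∩ g⁻¹ Π_ℍ g` for some `g` in the double coset of `d(K)`.  G1: for `ℍ = {v}` this is (D2); for the
identity covering it reads `ι(Π_ℍ) = Π_ℍ`. [cite: MochizukiSemiAnbd2006, Cor. 2.7(i) p.30] -/
def covering_subgraphComponents_doubleCosets : Prop :=
  ∀ (𝒢 𝒢' : SemiGraphOfAnabelioids.{v₁, u₁, u}) (φ : Hom 𝒢' 𝒢) (A : 𝒢.BObj),
    𝒢.IsConnected → 𝒢'.IsConnected → φ.IsFiniteEtaleCoveringOf A → φ.IsGlobalCoveringOf A →
    φ.IsVertexAligned →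
    ∀ (v' : 𝒢'.graph.Vertex) (F' : 𝒢'.V v' ⥤ FintypeCat.{v₁}) [FiberFunctor F']
      (F : 𝒢.V (φ.base.vertexMap v') ⥤ FintypeCat.{v₁}) [FiberFunctor F]
      (e : (φ.φV v').pullback ⋙ F' ≅ F)
      (H : 𝒢.graph.Subgraph), H.toSemiGraph.IsConnected → H.toSemiGraph.IsGraph →
      ∀ (hv : φ.base.vertexMap v' ∈ H.verts),
      let v := φ.base.vertexMap v'
      let ι : 𝒢'.Pi v' F' →* 𝒢.Pi v F :=
        (Aut.autMulEquivOfIso (Functor.isoWhiskerLeft (𝒢.ρ v) e)).toMonoidHom.comp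
          (pi1Map φ.pullbackFunctor (𝒢'.ρ v' ⋙ F'))
      let PH : Subgroup (𝒢.Pi v F) := (𝒢.piHToPi H ⟨v, hv⟩ F).range
      ∀ x₀ : (𝒢.ρ v ⋙ F).obj A, ι.range = MulAction.stabilizer (𝒢.Pi v F) x₀ →
        ∃ d : {K : 𝒢'.graph.Subgraph // φ.IsPreimageComponent H K} → 𝒢.Pi v F,
          Function.Bijective (fun K => DoubleCoset.mk PH ι.range (d K)) ∧
          (∃ K₀ : {K : 𝒢'.graph.Subgraph // φ.IsPreimageComponent H K}, v' ∈ K₀.1.verts) ∧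
          (∀ (K : {K : 𝒢'.graph.Subgraph // φ.IsPreimageComponent H K}) (hK : v' ∈ K.1.verts),
            d K ∈ ι.range ∧ (ι.comp (𝒢'.piHToPi K.1 ⟨v', hK⟩ F')).range = ι.range ⊓ PH) ∧
          ∀ (K : {K : 𝒢'.graph.Subgraph // φ.IsPreimageComponent H K})
            (w'' : K.1.toSemiGraph.Vertex) (F'' : 𝒢'.V w''.1 ⥤ FintypeCat.{v₁}) [FiberFunctor F'']
            (α : 𝒢'.ρ w''.1 ⋙ F'' ≅ 𝒢'.ρ v' ⋙ F'),
            ∃ g : 𝒢.Pi v F,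
              (ι.comp ((Aut.autMulEquivOfIso α).toMonoidHom.comp (𝒢'.piHToPi K.1 w'' F''))).range =
                ι.range ⊓ ConjAct.toConjAct g⁻¹ • PH

/-! ### (D4)–(D7): permanence of the standing hypotheses under finite étale coverings -/

/-- NAMED FACT (D4), IMPLICIT in [SemiAnbd] §2 (pp. 29–30: Prop. 2.6 is applied to finite étale
coverings of `𝒢`, whose hypotheses include "of injective type" via quasi-coherence, Def. 2.3): a
finite étale covering of a semi-graph of anabelioids of injective type is of injective type.  G1:
conclusion is the non-trivial `IsOfInjectiveType 𝒢′`. [cite: MochizukiSemiAnbd2006, Prop. 2.6 p.29] -/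
def covering_isOfInjectiveType : Prop :=
  ∀ (𝒢 𝒢' : SemiGraphOfAnabelioids.{v₁, u₁, u}) (φ : Hom 𝒢' 𝒢) (A : 𝒢.BObj),
    𝒢.IsConnected → φ.IsFiniteEtaleCoveringOf A → 𝒢.IsOfInjectiveType → 𝒢'.IsOfInjectiveType

/-- NAMED FACT (D5), IMPLICIT in [SemiAnbd] §2 (p. 29 l. −12 "by replacing `𝒢` by a finite étale
covering of `𝒢`"; p. 30 "assertion (i) follows from Proposition 2.6", applied to the covering `𝒢′`,
which must therefore be quasi-coherent): a connected finite étale covering of a connected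
quasi-coherent semi-graph of anabelioids is quasi-coherent.  G1: conclusion non-trivial; hypotheses
met by graph-coverings. [cite: MochizukiSemiAnbd2006, Prop. 2.6 p.29] -/
def covering_isQuasiCoherent : Prop :=
  ∀ (𝒢 𝒢' : SemiGraphOfAnabelioids.{v₁, u₁, u}) (φ : Hom 𝒢' 𝒢) (A : 𝒢.BObj),
    𝒢.IsConnected → 𝒢'.IsConnected → φ.IsFiniteEtaleCoveringOf A → φ.IsBranchAligned →
    𝒢.IsQuasiCoherent → 𝒢'.IsQuasiCoherent

/-- NAMED FACT (D6), IMPLICIT in [SemiAnbd] §2 (p. 30: Prop. 2.6 is applied in `𝒢′` to components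
whose vertices lie over elevated vertices of `𝒢`, cf. Cor. 2.7 "every vertex of `ℍ`, `𝕂` is elevated
[i.e., relative to `𝒢`]"): over a connected quasi-coherent `𝒢`, a vertex of a connected finite étale
covering `𝒢′` lying over an elevated vertex is elevated.  G1: conclusion non-trivial (Def. 2.4 (i)
for `𝒢′`). [cite: MochizukiSemiAnbd2006, Cor. 2.7 p.30] -/
def covering_isElevated : Prop :=
  ∀ (𝒢 𝒢' : SemiGraphOfAnabelioids.{v₁, u₁, u}) (φ : Hom 𝒢' 𝒢) (A : 𝒢.BObj),
    𝒢.IsConnected → 𝒢'.IsConnected → φ.IsFiniteEtaleCoveringOf A → φ.IsGlobalCoveringOf A →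
    φ.IsBranchAligned →
    𝒢.IsQuasiCoherent →
    ∀ v' : 𝒢'.graph.Vertex, 𝒢.IsElevated (φ.base.vertexMap v') → 𝒢'.IsElevated v'

/-- NAMED FACT (D7), IMPLICIT in [SemiAnbd] §2–§3 (Def. 2.4 (iv) conditions pass to finite étale
coverings: the branch groups of `𝒢′` are the intersections of those of `𝒢` with the open subgroup
`Π_{v′} ⊆ Π_v`; used whenever a totally estranged/aloof `𝒢` is replaced by a covering): a finite
étale covering of a totally estranged (resp. totally aloof) semi-graph of anabelioids is totally
estranged (resp. totally aloof).  G1: conclusions non-trivial. [cite: MochizukiSemiAnbd2006, Def. 2.4(iv) p.26] -/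
def covering_isTotallyEstranged : Prop :=
  ∀ (𝒢 𝒢' : SemiGraphOfAnabelioids.{v₁, u₁, u}) (φ : Hom 𝒢' 𝒢) (A : 𝒢.BObj),
    𝒢.IsConnected → φ.IsFiniteEtaleCoveringOf A → φ.IsGlobalCoveringOf A →
    φ.IsBranchAligned →
    (𝒢.IsTotallyEstranged → 𝒢'.IsTotallyEstranged) ∧ (𝒢.IsTotallyAloof → 𝒢'.IsTotallyAloof)

/-! ### Existence of the covering attached to an object, with all three clauses -/

/-- NAMED FACT, [SemiAnbd] §2 p. 23 and Prop. 2.6 proof ¶1 p. 30 ("we may pass to the finite étale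
covering `𝒢′ → 𝒢` determined by …"): for a connected semi-graph of anabelioids `𝒢` with a vertex and
every object `A` of `B(𝒢)`, there is a semi-graph of anabelioids `𝒢′` with a morphism `φ : 𝒢′ → 𝒢`
which is the finite étale covering attached to `A` LOCALLY (abc-iut-L3-t1's `IsFiniteEtaleCoveringOf`,
Def. 2.2 (i)), GLOBALLY (`IsGlobalCoveringOf`: `B(𝒢′) ≃ B(𝒢)_{/A}` via `φ^*`), with ALIGNED branch functors
(`IsBranchAligned`, abc-iut-L4-t17) and ALIGNED vertex groups (`IsVertexAligned`, abc-iut-L6-d4) —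
i.e. print's CONSTRUCTED covering `𝒢_A → 𝒢` (rulings μ2/π2/ρ2; discharger: abc-iut-L3-t5's
construction `BObj.coveringHom`).  Honest framing: the alignment clauses are satisfied by the
`B(𝒢)_{/A}`-construction (print's coverings, p. 23 / p. 30) and are explicit only because our
`Hom`-based predicates under-specify base points (tree-health RQ11/RQ14/RQ16/RQ17).  The weaker
two-clause `exists_finiteEtaleCovering_global` (`FiniteEtaleCoveringGlobal.lean`) and the local
`exists_finiteEtaleCovering` (`Coverticial.lean`) follow from it.
[cite: MochizukiSemiAnbd2006, Prop. 2.6 proof p.30] -/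
def exists_finiteEtaleCoveringGlobal : Prop :=
  ∀ (𝒢 : SemiGraphOfAnabelioids.{v₁, u₁, u}), 𝒢.IsConnected → Nonempty 𝒢.graph.Vertex →
    ∀ A : 𝒢.BObj, ∃ (𝒢' : SemiGraphOfAnabelioids.{v₁, u₁, u}) (φ : Hom 𝒢' 𝒢),
      φ.IsFiniteEtaleCoveringOf A ∧ φ.IsGlobalCoveringOf A ∧ φ.IsBranchAligned ∧ φ.IsVertexAligned

end SemiGraphOfAnabelioids

end Literature.AnabelianGeometry.SemiGraphs
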